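import Summits.AtomisticToContinuum.HydrodynamicLimit.Theses.OneFlightGossipEngine
import Summits.AtomisticToContinuum.HydrodynamicLimit.Theorems.JParityClosureOddContactSymmetryGibbsInvariance
import Summits.AtomisticToContinuum.HydrodynamicLimit.Theorems.EnergyCurrentTails.Negative.CubicTailExpMoment
import Literature.MathematicalPhysics.KineticTheory.HardSphereEulerProofs
import HarnessLib

/-!
# `EnergyCurrentTails` (stmt-AtomisticToContinuum-9235) at GLOBAL EQUILIBRIUM — the rung `λ = 0` of the
# line `IdeatorThreeSketch` (card `loschmidt-tagging-exergy`)

Helper file of the line lead (prover-line-stmt-AtomisticToContinuum-9235-0), `--supports` the crux.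
For CONSTANT profiles `(a₀, u₀, θ₀) ≡ (a, u, θ̄)` with `a, θ̄ > 0` and ANY constant drift `u`, every
`0 < σ < 1/2`, EVERY family of hard-sphere flows `Φ` and every `ε > 0` there is a cut-off `M`
(explicitly `M = E|w|⁴/ε + 1`, `w ∼ N(u, θ̄ I₃)`) with
`E_{λ_N} (N+1)⁻¹ ∑ᵢ 𝟙{M < |vᵢ(s)|}|vᵢ(s)|³ ≤ ε` for ALL `N` and ALL times `s ∈ ℝ`
(`energyCurrentTails_const`), and the crux's body verbatim at these profiles
(`energyCurrentTails_body_const`: `σ₀ = 1/2`, `N₀ = 0`, Euler solution and LLN hypothesis unused).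
This is the `F ≡ 1` case of the line's tagging identity / exergy influence bound (`Λ_s ≡ 1`): the
homogeneous Gibbs law is invariant under every hard-sphere flow
(`Theorems.lintegral_comp_flow_localGibbsLaw_const`, Liouville + energy/momentum conservation), so the
expected empirical cubic tail at time `s` is the STATIC one, which the disintegration
`lintegral_localGibbsMeasure` computes exactly as the one-body drifted-Gaussian cubic tail `T(M)`,
independent of `N`; and `T(M) ≤ M⁻¹ E|w|⁴ → 0` (Fernique).  The `u = 0` case was first checked by the
crux's standing disprover (`Cruxes/EnergyCurrentTails/EquilibriumRung.lean`, via a.e. uniqueness of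
flows); this file follows that computation with the drift restored and the invariance taken from the
landed `GibbsInvariance` theorem instead.

References: H. Spohn, *Large Scale Dynamics of Interacting Particles* (1991), Part I §2.3
(equilibrium measures are invariant under the dynamics).
-/

noncomputable section

open MeasureTheory Filter Set Topology
open scoped ENNReal

namespace Summit.AtomisticToContinuum.HydrodynamicLimit.Theorems.LoschmidtTagging

open Literature.MathematicalPhysics.KineticTheory Literature.Analysis.FluidPDE
open Summit.AtomisticToContinuum.HydrodynamicLimit.Theorems.EnergyCurrentTailsNegative

/-- **Static computation**: under the homogeneous local Gibbs law with constant drift `u` the expected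
empirical cubic tail is exactly the one-body drifted-Gaussian cubic tail, for every `N` (`σ ≤ 1/2`,
`a > 0`, `θ̄ > 0`). -/
theorem lintegral_cubicTail_eq_gaussTail {σ : ℝ} (hσ2 : σ ≤ 1 / 2) {a θb : ℝ} (ha : 0 < a)
    (hθ : 0 < θb) (u : V3) (N : ℕ) (M : ℝ) :
    ∫⁻ z, ENNReal.ofReal (cubicTail N M z)
        ∂(localGibbsMeasure σ (fun _ => a) (fun _ => u) (fun _ => θb) N) =
      ∫⁻ w, ENNReal.ofReal (tail3 M w) ∂(gaussMeasure u θb) := by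
  have hac : Continuous fun _ : T3 => a := continuous_const
  have hu : Continuous fun _ : T3 => u := continuous_const
  have hθc : Continuous fun _ : T3 => θb := continuous_const
  haveI := isProbabilityMeasure_localGibbsMeasure (u₀ := fun _ => u) hac hθc hu
    (fun _ => ha) (fun _ => hθ) hσ2 N
  have hGm : Measurable fun z : Config (N + 1) (Fin 3) T3 => ENNReal.ofReal (cubicTail N M z) :=
    (measurable_cubicTail N M).ennreal_ofReal
  rw [lintegral_localGibbsMeasure hac hθc hu (fun _ => ha.le) (fun _ => hθ) σ N hGm]
  have hmeas1 : Measurable fun w : V3 => ENNReal.ofReal (tail3 M w) :=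
    (measurable_tail3 M).ennreal_ofReal
  -- the inner (velocity) integral is the one-body tail, for every position vector
  have hinner : ∀ x : Fin (N + 1) → T3,
      ∫⁻ v, ENNReal.ofReal (cubicTail N M (zipConfig (x, v)))
          ∂velMeasure (fun _ => u) (fun _ => θb) x = ∫⁻ w, ENNReal.ofReal (tail3 M w) ∂(gaussMeasure u θb) := by
    intro x
    have hpt : ∀ v : Fin (N + 1) → V3, ENNReal.ofReal (cubicTail N M (zipConfig (x, v))) =
        ENNReal.ofReal (((N : ℝ) + 1)⁻¹) * ∑ i : Fin (N + 1), ENNReal.ofReal (tail3 M (v i)) := by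
      intro v
      unfold cubicTail
      simp only [zipConfig_apply]
      rw [ENNReal.ofReal_mul (by positivity),
        ENNReal.ofReal_sum_of_nonneg fun i _ => tail3_nonneg M _]
    have hterm : ∀ i : Fin (N + 1),
        ∫⁻ v, ENNReal.ofReal (tail3 M (v i)) ∂velMeasure (fun _ => u) (fun _ => θb) x =
          ∫⁻ w, ENNReal.ofReal (tail3 M w) ∂(gaussMeasure u θb) := by
      intro i
      unfold velMeasure
      exact (measurePreserving_eval (fun j : Fin (N + 1) =>
        gaussMeasure ((fun _ : T3 => u) (x j)) ((fun _ : T3 => θb) (x j))) i).lintegral_comp hmeas1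
    have hsm : Measurable fun v : Fin (N + 1) → V3 =>
        ∑ i : Fin (N + 1), ENNReal.ofReal (tail3 M (v i)) :=
      Finset.measurable_sum _ fun i _ => hmeas1.comp (measurable_pi_apply i)
    have hN : ENNReal.ofReal (((N : ℝ) + 1)⁻¹) * ((N + 1 : ℕ) : ℝ≥0∞) = 1 := by
      rw [ENNReal.ofReal_inv_of_pos (by positivity)]
      have : ENNReal.ofReal ((N : ℝ) + 1) = ((N + 1 : ℕ) : ℝ≥0∞) := by
        rw [show ((N : ℝ) + 1) = ((N + 1 : ℕ) : ℝ) by push_cast; ring, ENNReal.ofReal_natCast]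
      rw [this]
      exact ENNReal.inv_mul_cancel (by simp) (ENNReal.natCast_ne_top _)
    calc ∫⁻ v, ENNReal.ofReal (cubicTail N M (zipConfig (x, v)))
          ∂velMeasure (fun _ => u) (fun _ => θb) x
        = ∫⁻ v, ENNReal.ofReal (((N : ℝ) + 1)⁻¹) * ∑ i : Fin (N + 1), ENNReal.ofReal (tail3 M (v i))
            ∂velMeasure (fun _ => u) (fun _ => θb) x := lintegral_congr fun v => hpt v
      _ = ENNReal.ofReal (((N : ℝ) + 1)⁻¹) *
            ∫⁻ v, ∑ i : Fin (N + 1), ENNReal.ofReal (tail3 M (v i))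
              ∂velMeasure (fun _ => u) (fun _ => θb) x := lintegral_const_mul _ hsm
      _ = ENNReal.ofReal (((N : ℝ) + 1)⁻¹) *
            ∑ i : Fin (N + 1), ∫⁻ v, ENNReal.ofReal (tail3 M (v i))
              ∂velMeasure (fun _ => u) (fun _ => θb) x := by
          congr 1
          exact lintegral_finsetSum _ fun i _ => hmeas1.comp (measurable_pi_apply i)
      _ = ENNReal.ofReal (((N : ℝ) + 1)⁻¹) * ∑ _i : Fin (N + 1), ∫⁻ w, ENNReal.ofReal (tail3 M w) ∂(gaussMeasure u θb) := by
          congr 1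
          exact Finset.sum_congr rfl fun i _ => hterm i
      _ = ∫⁻ w, ENNReal.ofReal (tail3 M w) ∂(gaussMeasure u θb) := by
          rw [Finset.sum_const, Finset.card_univ, Fintype.card_fin, nsmul_eq_mul, ← mul_assoc, hN,
            one_mul]
  simp_rw [hinner]
  have hfm : Measurable fun x : Fin (N + 1) → T3 => ENNReal.ofReal
      ((canonicalPartition (Torus.geometry (Fin 3)) (hsDiameter σ N) (N + 1)
        (localGibbsProfile (fun _ => a) (fun _ => u) (fun _ => θb)))⁻¹ *
          posWeight (fun _ => a) (hsDiameter σ N) (N + 1) x) :=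
    ((measurable_posWeight hac _ _).const_mul _).ennreal_ofReal
  rw [lintegral_mul_const _ hfm, lintegral_posWeight_eq_one hac hθc hu (fun _ => ha.le)
    (fun _ => hθ) σ N, one_mul]

/-- **The one-body Gaussian cubic tail is small for large cut-offs**: `T(M) ≤ M⁻¹ E|w|⁴` for
`M > 0`. -/
theorem gaussTail_le (u : V3) {θb : ℝ} {M : ℝ} (hM : 0 < M) :
    ∫⁻ w, ENNReal.ofReal (tail3 M w) ∂(gaussMeasure u θb) ≤
      ENNReal.ofReal M⁻¹ * ∫⁻ w, ENNReal.ofReal (‖w‖ ^ 4) ∂(gaussMeasure u θb) := by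
  rw [← lintegral_const_mul _ (measurable_norm.pow_const 4).ennreal_ofReal]
  refine lintegral_mono fun w => ?_
  rw [← ENNReal.ofReal_mul (inv_nonneg.2 hM.le)]
  refine ENNReal.ofReal_le_ofReal ?_
  unfold tail3
  by_cases hw : M < ‖w‖
  · rw [Set.indicator_of_mem (show w ∈ {v : V3 | M < ‖v‖} from hw)]
    rw [le_inv_mul_iff₀ hM]
    calc M * ‖w‖ ^ 3 ≤ ‖w‖ * ‖w‖ ^ 3 :=
          mul_le_mul_of_nonneg_right hw.le (by positivity)
      _ = ‖w‖ ^ 4 := by ring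
  · rw [Set.indicator_of_notMem (show w ∉ {v : V3 | M < ‖v‖} from hw)]
    positivity

/-- `E|w|⁴ < ∞` under a (drifted) Gaussian (Fernique / Gaussian moments). -/
theorem lintegral_norm_pow_four_lt_top (u : V3) (θb : ℝ) :
    ∫⁻ w, ENNReal.ofReal (‖w‖ ^ 4) ∂(gaussMeasure u θb) < ∞ := by
  have h4 : Integrable (fun v : V3 => ‖v‖ ^ 4) (gaussMeasure u θb) :=
    (ProbabilityTheory.IsGaussian.memLp_id _ 4 (by simp)).integrable_norm_pow (by norm_num)
  exact h4.lintegral_lt_top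

/-- **`EnergyCurrentTails` at global equilibrium with drift.**  For constant profiles `(a, u, θ̄)`
with `a, θ̄ > 0`, every `0 < σ < 1/2`, every family of hard-sphere flows and every `ε > 0` there is a
cut-off `M` (explicitly `M = E|w|⁴/ε + 1`, `w ∼ N(u, θ̄ I₃)`) such that the crux's expected empirical
cubic tail is `≤ ε` for ALL `N` and ALL times `s` — the conclusion of the crux in its exact currency,
with no `N₀` and no horizon.  Invariance of the homogeneous Gibbs law under every flow
(`lintegral_comp_flow_localGibbsLaw_const`) + the static computation. -/
theorem energyCurrentTails_const {σ a θb : ℝ} (u : V3) (hσ : 0 < σ) (hσ2 : σ < 1 / 2) (ha : 0 < a)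
    (hθ : 0 < θb)
    (Φ : (N : ℕ) → HardSphereFlow (Torus.geometry (Fin 3)) (hsDiameter σ N) (N + 1))
    {ε : ℝ} (hε : 0 < ε) :
    ∃ M : ℝ, ∀ N : ℕ, ∀ s : ℝ,
      ∫⁻ z, ENNReal.ofReal (((N : ℝ) + 1)⁻¹ * ∑ i : Fin (N + 1),
          Set.indicator {v : V3 | M < ‖v‖} (fun v => ‖v‖ ^ 3) (((Φ N).flow s z i).2))
        ∂(localGibbsLaw σ (fun _ => a) (fun _ => u) (fun _ => θb) N (Φ N)) ≤ ENNReal.ofReal ε := by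
  have _ := hσ
  set C4 : ℝ≥0∞ := ∫⁻ w, ENNReal.ofReal (‖w‖ ^ 4) ∂(gaussMeasure u θb) with hC4
  have hC4top : C4 ≠ ⊤ := (lintegral_norm_pow_four_lt_top u θb).ne
  refine ⟨C4.toReal / ε + 1, fun N s => ?_⟩
  have hC4r : 0 ≤ C4.toReal := ENNReal.toReal_nonneg
  have hM : 0 < C4.toReal / ε + 1 := by positivity
  have hF : Measurable fun z : Config (N + 1) (Fin 3) T3 =>
      ENNReal.ofReal (cubicTail N (C4.toReal / ε + 1) z) :=
    (measurable_cubicTail N _).ennreal_ofReal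
  have h1 := Summit.AtomisticToContinuum.HydrodynamicLimit.Theorems.lintegral_comp_flow_localGibbsLaw_const
    σ a θb u N (Φ N) s hF
  show ∫⁻ z, ENNReal.ofReal (cubicTail N (C4.toReal / ε + 1) ((Φ N).flow s z))
      ∂(localGibbsLaw σ (fun _ => a) (fun _ => u) (fun _ => θb) N (Φ N)) ≤ ENNReal.ofReal ε
  rw [h1, localGibbsLaw_eq, lintegral_cubicTail_eq_gaussTail hσ2.le ha hθ u N]
  calc ∫⁻ w, ENNReal.ofReal (tail3 (C4.toReal / ε + 1) w) ∂(gaussMeasure u θb)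
      ≤ ENNReal.ofReal (C4.toReal / ε + 1)⁻¹ * C4 := gaussTail_le u hM
    _ = ENNReal.ofReal ((C4.toReal / ε + 1)⁻¹ * C4.toReal) := by
        rw [ENNReal.ofReal_mul (inv_nonneg.2 hM.le), ENNReal.ofReal_toReal hC4top]
    _ ≤ ENNReal.ofReal ε := by
        refine ENNReal.ofReal_le_ofReal ?_
        rw [inv_mul_le_iff₀ hM, add_mul, div_mul_cancel₀ _ hε.ne']
        linarith

/-- **Registered audit stub `stub_equilibriumRung`** of the line `IdeatorThreeSketch` (crux
stmt-AtomisticToContinuum-9235): the crux's conclusion for CONSTANT profiles `(a, u, θ̄)`, `a, θ̄ > 0`,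
any constant drift `u`, every `0 < σ < 1/2`, every flow family and every `ε > 0`, with one cut-off
`M` for ALL `N` and ALL times `s` (restatement of `energyCurrentTails_const` as a closed `Prop`). -/
theorem stub_equilibriumRung :
    ∀ (σ a θb : ℝ) (u : V3), 0 < σ → σ < 1 / 2 → 0 < a → 0 < θb →
      ∀ (Φ : (N : ℕ) → HardSphereFlow (Torus.geometry (Fin 3)) (hsDiameter σ N) (N + 1)) (ε : ℝ),
        0 < ε → ∃ M : ℝ, ∀ (N : ℕ) (s : ℝ),
          ∫⁻ z, ENNReal.ofReal (((N : ℝ) + 1)⁻¹ * ∑ i : Fin (N + 1),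
              Set.indicator {v : V3 | M < ‖v‖} (fun v => ‖v‖ ^ 3) (((Φ N).flow s z i).2))
            ∂(localGibbsLaw σ (fun _ => a) (fun _ => u) (fun _ => θb) N (Φ N)) ≤ ENNReal.ofReal ε :=
  fun _σ _a _θb u hσ hσ2 ha hθ Φ _ε hε => energyCurrentTails_const u hσ hσ2 ha hθ Φ hε

/-- **The crux's body, verbatim, at constant profiles** `(a₀, u₀, θ₀) ≡ (a, u, θ̄)`, `a, θ̄ > 0`: what
`EnergyCurrentTails` asserts after its five profile hypotheses, with `σ₀ = 1/2`, `N₀ = 0`, the Euler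
solution and the LLN hypothesis unused (they only bound the horizon).  The equilibrium rung of the
crux: any counterexample must be genuinely out of equilibrium. -/
theorem energyCurrentTails_body_const {a θb : ℝ} (u : V3) (ha : 0 < a) (hθ : 0 < θb) :
    ∃ σ₀ : ℝ, 0 < σ₀ ∧ ∀ σ : ℝ, 0 < σ → σ < σ₀ →
      ∀ (T : ℝ) (ρ θ : ℝ → T3 → ℝ) (u' : ℝ → T3 → V3), IsHardSphereEulerSolution σ T ρ u' θ →
        ∀ Φ : (N : ℕ) → HardSphereFlow (Torus.geometry (Fin 3)) (hsDiameter σ N) (N + 1),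
          TendstoHydroFieldsAt
              (fun N => localGibbsLaw σ (fun _ => a) (fun _ => u) (fun _ => θb) N (Φ N)) Φ ρ u' θ 0 →
            ∀ t ∈ Set.Ico 0 T, ∀ ε : ℝ, 0 < ε → ∃ M : ℝ, ∃ N₀ : ℕ, ∀ N : ℕ, N₀ ≤ N →
              ∀ s ∈ Set.Icc 0 t,
                ∫⁻ z, ENNReal.ofReal (((N : ℝ) + 1)⁻¹ * ∑ i : Fin (N + 1),
                    Set.indicator {v : V3 | M < ‖v‖} (fun v => ‖v‖ ^ 3) (((Φ N).flow s z i).2))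
                  ∂(localGibbsLaw σ (fun _ => a) (fun _ => u) (fun _ => θb) N (Φ N)) ≤
                  ENNReal.ofReal ε := by
  refine ⟨1 / 2, by norm_num, fun σ hσ hσ2 T ρ θ u' _ Φ _ t _ ε hε => ?_⟩
  obtain ⟨M, hM⟩ := energyCurrentTails_const u hσ hσ2 ha hθ Φ hε
  exact ⟨M, 0, fun N _ s _ => hM N s⟩

/-- **`EnergyCurrentTails` restricted to constant profiles** (the crux with its three profile
arguments specialised to constants): every constant-profile instance of
`OneFlightGossipEngine.EnergyCurrentTails` holds, with `σ₀ = 1/2`. -/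
theorem energyCurrentTails_of_const_profiles (a θb : ℝ) (u : V3) :
    Continuous (fun _ : T3 => a) → Continuous (fun _ : T3 => θb) → Continuous (fun _ : T3 => u) →
      (∀ _x : T3, 0 < a) → (∀ _x : T3, 0 < θb) →
      ∃ σ₀ : ℝ, 0 < σ₀ ∧ ∀ σ : ℝ, 0 < σ → σ < σ₀ →
        ∀ (T : ℝ) (ρ θ : ℝ → T3 → ℝ) (u' : ℝ → T3 → V3), IsHardSphereEulerSolution σ T ρ u' θ →
          ∀ Φ : (N : ℕ) → HardSphereFlow (Torus.geometry (Fin 3)) (hsDiameter σ N) (N + 1),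
            TendstoHydroFieldsAt
                (fun N => localGibbsLaw σ (fun _ => a) (fun _ => u) (fun _ => θb) N (Φ N)) Φ ρ u' θ 0 →
              ∀ t ∈ Set.Ico 0 T, ∀ ε : ℝ, 0 < ε → ∃ M : ℝ, ∃ N₀ : ℕ, ∀ N : ℕ, N₀ ≤ N →
                ∀ s ∈ Set.Icc 0 t,
                  ∫⁻ z, ENNReal.ofReal (((N : ℝ) + 1)⁻¹ * ∑ i : Fin (N + 1),
                      Set.indicator {v : V3 | M < ‖v‖} (fun v => ‖v‖ ^ 3) (((Φ N).flow s z i).2))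
                    ∂(localGibbsLaw σ (fun _ => a) (fun _ => u) (fun _ => θb) N (Φ N)) ≤
                    ENNReal.ofReal ε := by
  intro _ _ _ ha hθ
  haveI : Nonempty T3 := inferInstance
  exact energyCurrentTails_body_const u (ha (Classical.arbitrary T3)) (hθ (Classical.arbitrary T3))

end Summit.AtomisticToContinuum.HydrodynamicLimit.Theorems.LoschmidtTagging

end
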